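import Mathlib.Algebra.Order.BigOperators.Group.Finset
import Mathlib.Algebra.Order.Floor.Semiring
import Mathlib.Order.Interval.Finset.Nat
import Mathlib.Tactic

/-!
# SoloInformedConvexSpacing — integer points on a convex graph: the three-point lemma and the count

Solo unit `solo-Parity-informed` (ideation tier, informed mode), session 15; `PLAN.md` §23, CLAIMS C65.

The `s = 2` case of the divided-difference argument for lattice points on curves (Jarník 1926; cf.
Montgomery–Vaughan, *Multiplicative Number Theory I*, Exercise 2.1.7; Bombieri–Pila 1989), in the form used
for perfect-power values of polynomials (`SoloInformedMidPowerValues`):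

* `four_le_mul_cube_of_slopes`: if three integer points `(n₀, m₀), (n₁, m₁), (n₂, m₂)`, `n₀ < n₁ < n₂`, have
  INCREASING chord slopes whose increase is at most `c (n₂ - n₀)`, then `4 ≤ c (n₂ - n₀)³` — because the
  slope increase is a positive rational with denominator `≤ (n₁ - n₀)(n₂ - n₁) ≤ (n₂ - n₀)²/4`.
* `card_le_of_three_spacing`: a subset of `[N₀, x]` any three of whose elements span `≥ L` has at most
  `2((x - N₀)/L + 1)` elements.

Pure counting; no analysis.  No bearing on the truth of any conjecture.
-/

namespace Summit.Parity.BatemanHorn.Theorems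

open Finset

/-- **Three-point lemma.**  Integer points `n₀ < n₁ < n₂` with integer ordinates `m₀, m₁, m₂` whose chord
slopes increase, by at most `c (n₂ - n₀)`, satisfy `4 ≤ c (n₂ - n₀)³`. -/
theorem four_le_mul_cube_of_slopes {n₀ n₁ n₂ : ℕ} (m₀ m₁ m₂ : ℤ) (h₀₁ : n₀ < n₁) (h₁₂ : n₁ < n₂)
    {c : ℝ}
    (hlt : ((m₁ : ℝ) - m₀) / ((n₁ : ℝ) - n₀) < ((m₂ : ℝ) - m₁) / ((n₂ : ℝ) - n₁))
    (hle : ((m₂ : ℝ) - m₁) / ((n₂ : ℝ) - n₁) - ((m₁ : ℝ) - m₀) / ((n₁ : ℝ) - n₀)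
      ≤ c * ((n₂ : ℝ) - n₀)) :
    4 ≤ c * ((n₂ : ℝ) - n₀) ^ 3 := by
  -- the gaps `a, b > 0` and the rises `u, v`
  obtain ⟨a, rfl⟩ : ∃ a : ℕ, n₁ = n₀ + a + 1 := ⟨n₁ - n₀ - 1, by omega⟩
  obtain ⟨b, rfl⟩ : ∃ b : ℕ, n₂ = n₀ + a + 1 + b + 1 := ⟨n₂ - (n₀ + a + 1) - 1, by omega⟩
  set u : ℤ := m₁ - m₀ with hu
  set v : ℤ := m₂ - m₁ with hv
  set A : ℝ := (a : ℝ) + 1 with hA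
  set B : ℝ := (b : ℝ) + 1 with hB
  have hA0 : 0 < A := by positivity
  have hB0 : 0 < B := by positivity
  have e₁ : ((n₀ + a + 1 : ℕ) : ℝ) - n₀ = A := by push_cast; ring
  have e₂ : ((n₀ + a + 1 + b + 1 : ℕ) : ℝ) - ((n₀ + a + 1 : ℕ) : ℝ) = B := by push_cast; ring
  have e₃ : ((n₀ + a + 1 + b + 1 : ℕ) : ℝ) - n₀ = A + B := by push_cast; ring
  have eu : (m₁ : ℝ) - m₀ = (u : ℝ) := by rw [hu]; push_cast; ring
  have ev : (m₂ : ℝ) - m₁ = (v : ℝ) := by rw [hv]; push_cast; ring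
  rw [e₁, e₂, eu, ev] at hlt hle
  rw [e₃] at hle ⊢
  -- `u B < v A`, an inequality of integers: `u (b+1) + 1 ≤ v (a+1)`
  have hlt' : (u : ℝ) * B < v * A := by
    have := (div_lt_div_iff₀ hA0 hB0).mp hlt
    linarith
  have hint : u * (b + 1) + 1 ≤ v * (a + 1) := by
    have h : (u : ℝ) * (b + 1) < v * (a + 1) := by rw [hA, hB] at hlt'; exact hlt'
    have h' : u * (b + 1) < v * (a + 1) := by exact_mod_cast h
    omega
  have hintR : (u : ℝ) * B + 1 ≤ v * A := by
    have : ((u * (b + 1) + 1 : ℤ) : ℝ) ≤ ((v * (a + 1) : ℤ) : ℝ) := by exact_mod_cast hint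
    push_cast at this
    rw [hA, hB]
    linarith
  -- hence the slope increase is `≥ 1/(AB)` and `1 ≤ c A B (A + B)`
  have hdiff : 1 / (A * B) ≤ (v : ℝ) / B - u / A := by
    rw [div_sub_div _ _ hB0.ne' hA0.ne', div_le_div_iff₀ (by positivity) (by positivity)]
    have h0 : 0 ≤ (v : ℝ) * A - B * u - 1 := by linarith
    nlinarith [mul_nonneg h0 (mul_pos hA0 hB0).le]
  have h1 : 1 ≤ c * (A * B * (A + B)) := by
    have h := hdiff.trans hle
    rw [div_le_iff₀ (by positivity)] at h
    linarith
  -- and `4 A B (A + B) ≤ (A + B)³`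
  have hc : 0 < c := by
    by_contra hc
    push Not at hc
    have : c * (A * B * (A + B)) ≤ 0 := mul_nonpos_of_nonpos_of_nonneg hc (by positivity)
    linarith
  have h4 : 4 * (A * B * (A + B)) ≤ (A + B) ^ 3 := by nlinarith [sq_nonneg (A - B)]
  nlinarith [h4, h1, hc]

/-- **Counting under three-point spacing.**  If any three elements `n₀ < n₁ < n₂` of `T ⊆ [N₀, x]` satisfy
`L ≤ n₂ - n₀` (`L > 0`), then `#T ≤ 2((x - N₀)/L + 1)`: each block of the partition of `[N₀, x]` into
intervals of length `L` holds at most two elements. -/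
theorem card_le_of_three_spacing {T : Finset ℕ} {N₀ x : ℕ} (hT : T ⊆ Icc N₀ x) (hx : N₀ ≤ x) {L : ℝ}
    (hL : 0 < L)
    (hsep : ∀ n₀ ∈ T, ∀ n₁ ∈ T, ∀ n₂ ∈ T, n₀ < n₁ → n₁ < n₂ → L ≤ (n₂ : ℝ) - n₀) :
    (#T : ℝ) ≤ 2 * (((x : ℝ) - N₀) / L + 1) := by
  have hx' : (0 : ℝ) ≤ (x : ℝ) - N₀ := by
    have : (N₀ : ℝ) ≤ x := by exact_mod_cast hx
    linarith
  set φ : ℕ → ℕ := fun n => ⌊((n : ℝ) - N₀) / L⌋₊ with hφ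
  -- the image lies in `range (⌊(x - N₀)/L⌋ + 1)`
  have himg : T.image φ ⊆ range (⌊((x : ℝ) - N₀) / L⌋₊ + 1) := by
    intro j hj
    obtain ⟨n, hn, rfl⟩ := mem_image.mp hj
    have hnx : n ≤ x := (mem_Icc.mp (hT hn)).2
    rw [mem_range, Nat.lt_succ_iff, hφ]
    exact Nat.floor_le_floor (div_le_div_of_nonneg_right (by gcongr) hL.le)
  -- two elements with the same block index are `< L` apart
  have hclose : ∀ p ∈ T, ∀ r ∈ T, p ≤ r → φ p = φ r → (r : ℝ) - p < L := by
    intro p hp r hr hpr hφpr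
    have hN₀p : (N₀ : ℝ) ≤ p := by exact_mod_cast (mem_Icc.mp (hT hp)).1
    have hup : 0 ≤ ((p : ℝ) - N₀) / L := div_nonneg (by linarith) hL.le
    have h1 : (⌊((p : ℝ) - N₀) / L⌋₊ : ℝ) ≤ ((p : ℝ) - N₀) / L := Nat.floor_le hup
    have h2 : ((r : ℝ) - N₀) / L < (⌊((r : ℝ) - N₀) / L⌋₊ : ℝ) + 1 := Nat.lt_floor_add_one _
    have h3 : (⌊((p : ℝ) - N₀) / L⌋₊ : ℝ) = (⌊((r : ℝ) - N₀) / L⌋₊ : ℝ) := by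
      simp only [hφ] at hφpr
      exact_mod_cast hφpr
    have h4 : ((r : ℝ) - N₀) / L < ((p : ℝ) - N₀) / L + 1 := by linarith
    rw [div_lt_iff₀ hL, add_mul, div_mul_cancel₀ _ hL.ne', one_mul] at h4
    linarith
  -- every fibre has at most two elements
  have hfib : ∀ j ∈ T.image φ, #(T.filter fun n => φ n = j) ≤ 2 := by
    intro j _
    by_contra h
    push Not at h
    set F := T.filter (fun n => φ n = j) with hF
    obtain ⟨p, hp, q, hq, r, hr, hpq, hpr, hqr⟩ := two_lt_card.mp h
    -- sort the three elements
    have key : ∀ p ∈ F, ∀ q ∈ F, ∀ r ∈ F, p < q → q < r → False := by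
      intro p hp q hq r hr hpq hqr
      obtain ⟨hpT, hpj⟩ := mem_filter.mp hp
      obtain ⟨hqT, -⟩ := mem_filter.mp hq
      obtain ⟨hrT, hrj⟩ := mem_filter.mp hr
      have h1 := hsep p hpT q hqT r hrT hpq hqr
      have h2 := hclose p hpT r hrT (hpq.le.trans hqr.le) (hpj.trans hrj.symm)
      linarith
    rcases lt_trichotomy p q with hpq' | hpq' | hpq'
    · rcases lt_trichotomy q r with hqr' | hqr' | hqr'
      · exact key p hp q hq r hr hpq' hqr'
      · exact hqr hqr'
      · rcases lt_trichotomy p r with hpr' | hpr' | hpr'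
        · exact key p hp r hr q hq hpr' hqr'
        · exact hpr hpr'
        · exact key r hr p hp q hq hpr' hpq'
    · exact hpq hpq'
    · rcases lt_trichotomy p r with hpr' | hpr' | hpr'
      · exact key q hq p hp r hr hpq' hpr'
      · exact hpr hpr'
      · rcases lt_trichotomy q r with hqr' | hqr' | hqr'
        · exact key q hq r hr p hp hqr' hpr'
        · exact hqr hqr'
        · exact key r hr q hq p hp hqr' hpq'
  have hcard := card_le_mul_card_image T 2 hfib
  have himg' := (card_le_card himg)
  rw [card_range] at himg'
  calc (#T : ℝ) ≤ ((2 * #(T.image φ) : ℕ) : ℝ) := by exact_mod_cast hcard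
    _ ≤ ((2 * (⌊((x : ℝ) - N₀) / L⌋₊ + 1) : ℕ) : ℝ) := by exact_mod_cast Nat.mul_le_mul_left 2 himg'
    _ ≤ 2 * (((x : ℝ) - N₀) / L + 1) := by
        push_cast
        linarith [Nat.floor_le (div_nonneg hx' hL.le)]

end Summit.Parity.BatemanHorn.Theorems
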